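import Literature.Topology.FourManifolds.PLUniquenessStage
import Mathlib.Geometry.Manifold.Metrizable
import Mathlib.Topology.Compactness.SigmaCompact
import HarnessLib

/-!
# Uniqueness of Whitehead-compatible PL structures: pieces, orbits and constants

Towards `Literature.Topology.FourManifolds.nonempty_plHomeomorph_of_isWhiteheadCompatible`
(Munkres (1966), Thm 10.5): the global bookkeeping of the uniqueness induction.

* `orbit_mem_succ` — **the orbit lemma**: for an increasing sequence of sets `K i` with metric
  gaps `δ i`, and maps `Φ t` each moving points by at most `lam t` inside a support lying in
  `K (lev t + 1)` and missing `K i` for `i + 2 ≤ lev t`, if the displacements of the maps of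
  levels `i, i+1, i+2` sum to less than `δ i` then orbits of points of `K i` stay in `K (i+1)`
  (the moves between the last visit to `K i` and an exit from `K (i + 1)` are all by maps of
  those three levels);
* `UPieces` — a countable family of cover pieces (`UPiece`) adapted to a compact exhaustion, with
  levels, finitely many pieces up to each level, cores covering `M`, and top balls inside the two
  PL chart sources; `exists_uPieces` constructs one on every second countable Hausdorff manifold
  carrying the three atlases.

No named facts are introduced.

## References

* J.R. Munkres, *Elementary differential topology*, Ann. of Math. Studies 54 (1963; rev. 1966),
  §10, Thms 10.4–10.6 (the limiting argument). [Munkres1966]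
-/

open Set Function Metric Filter
open scoped Topology Manifold NNReal

noncomputable section

namespace Literature.Topology.FourManifolds

local notation "𝔼 " n:arg => EuclideanSpace ℝ (Fin n)

/-! ### The orbit lemma -/

section OrbitDef

variable {X : Type*}

/-- The orbit of `x` under the maps `Φ 0, Φ 1, …`: `orbit Φ x T = Φ (T-1) (⋯ (Φ 0 x))`. [folklore] -/
def orbit (Φ : ℕ → X → X) (x : X) : ℕ → X
  | 0 => x
  | T + 1 => Φ T (orbit Φ x T)

/-- Auxiliary (`orbit_zero`). [folklore] -/
@[simp] theorem orbit_zero (Φ : ℕ → X → X) (x : X) : orbit Φ x 0 = x := rfl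

/-- Auxiliary (`orbit_succ`). [folklore] -/
@[simp] theorem orbit_succ (Φ : ℕ → X → X) (x : X) (T : ℕ) : orbit Φ x (T + 1) = Φ T (orbit Φ x T) := rfl

/-- If the maps from time `T₀` on fix the orbit point, the orbit is constant from `T₀` on.
[folklore] -/
theorem orbit_eq_of_forall {Φ : ℕ → X → X} {x : X} {T₀ : ℕ}
    (h : ∀ T, T₀ ≤ T → Φ T (orbit Φ x T) = orbit Φ x T) {T : ℕ} (hT : T₀ ≤ T) :
    orbit Φ x T = orbit Φ x T₀ := by
  induction T with
  | zero => rw [Nat.le_zero.1 hT]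
  | succ T ih =>
    rcases hT.lt_or_eq with hlt | heq
    · rw [orbit_succ, h T (Nat.lt_succ_iff.1 hlt), ih (Nat.lt_succ_iff.1 hlt)]
    · rw [heq]

end OrbitDef

section Orbit

variable {X : Type*} [PseudoMetricSpace X]

/-- **The orbit lemma.** See the module docstring. [cite: Munkres1966, proof of Thm 10.4] -/
theorem orbit_mem_succ (K : ℕ → Set X) (hK : Monotone K) (δ : ℕ → ℝ)
    (hδ : ∀ i, ∀ x ∈ K i, ∀ y, y ∉ K (i + 1) → δ i ≤ dist x y)
    (Φ : ℕ → X → X) (S : ℕ → Set X) (lev : ℕ → ℕ) (lam : ℕ → ℝ) (hlam : ∀ t, 0 ≤ lam t)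
    (hsupp : ∀ t x, Φ t x ≠ x → x ∈ S t ∧ Φ t x ∈ S t)
    (hdisp : ∀ t x, dist (Φ t x) x ≤ lam t)
    (hS₁ : ∀ t, S t ⊆ K (lev t + 1)) (hS₂ : ∀ t i, i + 2 ≤ lev t → Disjoint (S t) (K i))
    (hsum : ∀ i (s : Finset ℕ), (∀ t ∈ s, i ≤ lev t ∧ lev t ≤ i + 2) → ∑ t ∈ s, lam t < δ i)
    (i : ℕ) {x : X} (hx : x ∈ K i) (T : ℕ) : orbit Φ x T ∈ K (i + 1) := by
  classical
  -- the band of levels and the budget between two times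
  set band : ℕ → Prop := fun t => i ≤ lev t ∧ lev t ≤ i + 2 with hband
  set budget : ℕ → ℕ → ℝ := fun T' T => ∑ t ∈ (Finset.Ico T' T).filter band, lam t with hbudget
  have hbudget_lt : ∀ T' T, budget T' T < δ i := fun T' T =>
    hsum i _ fun t ht => (Finset.mem_filter.1 ht).2
  have hbudget_nonneg : ∀ T' T, 0 ≤ budget T' T := fun T' T =>
    Finset.sum_nonneg fun t _ => hlam t
  -- from the budget bound to membership in `K (i+1)`
  have hmem : ∀ {y z : X}, y ∈ K i → dist y z < δ i → z ∈ K (i + 1) := by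
    intro y z hy hd
    by_contra hz
    exact absurd (hδ i y hy z hz) (not_le.2 hd)
  -- the claim: there is a last visit `T' ≤ T` to `K i` with distance bounded by the budget
  have claim : ∀ T, ∃ T' ≤ T, orbit Φ x T' ∈ K i ∧ dist (orbit Φ x T') (orbit Φ x T) ≤ budget T' T := by
    intro T
    induction T with
    | zero => exact ⟨0, le_rfl, hx, by simp [hbudget]⟩
    | succ T ih =>
      obtain ⟨T', hT'T, hT'K, hdist⟩ := ih
      by_cases hin : orbit Φ x (T + 1) ∈ K i
      · exact ⟨T + 1, le_rfl, hin, by simp [hbudget]⟩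
      have hTK : orbit Φ x T ∈ K (i + 1) := hmem hT'K (hdist.trans_lt (hbudget_lt T' T))
      -- the budget only grows
      have hmono : budget T' T ≤ budget T' (T + 1) := by
        simp only [hbudget]
        refine Finset.sum_le_sum_of_subset_of_nonneg (Finset.filter_subset_filter _
          (Finset.Ico_subset_Ico_right (Nat.le_succ T))) fun t _ _ => hlam t
      by_cases hmove : Φ T (orbit Φ x T) = orbit Φ x T
      · refine ⟨T', hT'T.trans (Nat.le_succ T), hT'K, ?_⟩
        rw [orbit_succ, hmove]
        exact hdist.trans hmono
      · obtain ⟨hS, hS'⟩ := hsupp T _ hmove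
        -- the level of the move lies in the band
        have hlev₁ : i ≤ lev T := by
          by_contra hlt
          push Not at hlt
          have h1 : S T ⊆ K i := (hS₁ T).trans (hK (by omega))
          exact hin (by rw [orbit_succ]; exact h1 hS')
        have hlev₂ : lev T ≤ i + 2 := by
          by_contra hlt
          push Not at hlt
          have h := hS₂ T (i + 1) (by omega)
          exact Set.disjoint_left.1 h hS hTK
        have hbandT : band T := ⟨hlev₁, hlev₂⟩
        refine ⟨T', hT'T.trans (Nat.le_succ T), hT'K, ?_⟩
        calc dist (orbit Φ x T') (orbit Φ x (T + 1))
            ≤ dist (orbit Φ x T') (orbit Φ x T) + dist (orbit Φ x T) (orbit Φ x (T + 1)) := dist_triangle _ _ _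
          _ ≤ budget T' T + lam T := by
              rw [orbit_succ, dist_comm (orbit Φ x T)]
              exact add_le_add hdist (hdisp T _)
          _ = budget T' (T + 1) := by
              simp only [hbudget]
              rw [Finset.sum_filter, Finset.sum_filter, Finset.sum_Ico_succ_top hT'T, if_pos hbandT]
  obtain ⟨T', -, hT'K, hdist⟩ := claim T
  exact hmem hT'K (hdist.trans_lt (hbudget_lt T' T))

/-- **The orbit lemma, downward version**: orbits of points outside `K (i+1)` stay outside `K i`.
[cite: Munkres1966, proof of Thm 10.4] -/
theorem orbit_notMem (K : ℕ → Set X) (hK : Monotone K) (δ : ℕ → ℝ)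
    (hδ : ∀ i, ∀ x ∈ K i, ∀ y, y ∉ K (i + 1) → δ i ≤ dist x y)
    (Φ : ℕ → X → X) (S : ℕ → Set X) (lev : ℕ → ℕ) (lam : ℕ → ℝ) (hlam : ∀ t, 0 ≤ lam t)
    (hsupp : ∀ t x, Φ t x ≠ x → x ∈ S t ∧ Φ t x ∈ S t)
    (hdisp : ∀ t x, dist (Φ t x) x ≤ lam t)
    (hS₁ : ∀ t, S t ⊆ K (lev t + 1)) (hS₂ : ∀ t i, i + 2 ≤ lev t → Disjoint (S t) (K i))
    (hsum : ∀ i (s : Finset ℕ), (∀ t ∈ s, i ≤ lev t ∧ lev t ≤ i + 2) → ∑ t ∈ s, lam t < δ i)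
    (i : ℕ) {x : X} (hx : x ∉ K (i + 1)) (T : ℕ) : orbit Φ x T ∉ K i := by
  classical
  set band : ℕ → Prop := fun t => i ≤ lev t ∧ lev t ≤ i + 2 with hband
  set budget : ℕ → ℕ → ℝ := fun T' T => ∑ t ∈ (Finset.Ico T' T).filter band, lam t with hbudget
  have hbudget_lt : ∀ T' T, budget T' T < δ i := fun T' T =>
    hsum i _ fun t ht => (Finset.mem_filter.1 ht).2
  -- from the budget bound to non-membership in `K i`
  have hmem : ∀ {y z : X}, y ∉ K (i + 1) → dist y z < δ i → z ∉ K i := by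
    intro y z hy hd hz
    have := hδ i z hz y hy
    rw [dist_comm] at this
    exact absurd this (not_le.2 hd)
  have claim : ∀ T, ∃ T' ≤ T, orbit Φ x T' ∉ K (i + 1) ∧ dist (orbit Φ x T') (orbit Φ x T) ≤ budget T' T := by
    intro T
    induction T with
    | zero => exact ⟨0, le_rfl, hx, by simp [hbudget]⟩
    | succ T ih =>
      obtain ⟨T', hT'T, hT'K, hdist⟩ := ih
      by_cases hin : orbit Φ x (T + 1) ∉ K (i + 1)
      · exact ⟨T + 1, le_rfl, hin, by simp [hbudget]⟩
      push Not at hin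
      have hTK : orbit Φ x T ∉ K i := hmem hT'K (hdist.trans_lt (hbudget_lt T' T))
      have hmono : budget T' T ≤ budget T' (T + 1) := by
        simp only [hbudget]
        refine Finset.sum_le_sum_of_subset_of_nonneg (Finset.filter_subset_filter _
          (Finset.Ico_subset_Ico_right (Nat.le_succ T))) fun t _ _ => hlam t
      by_cases hmove : Φ T (orbit Φ x T) = orbit Φ x T
      · refine ⟨T', hT'T.trans (Nat.le_succ T), hT'K, ?_⟩
        rw [orbit_succ, hmove]
        exact hdist.trans hmono
      · obtain ⟨hS, hS'⟩ := hsupp T _ hmove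
        have hlev₁ : i ≤ lev T := by
          by_contra hlt
          push Not at hlt
          have h1 : S T ⊆ K i := (hS₁ T).trans (hK (by omega))
          exact hTK (h1 hS)
        have hlev₂ : lev T ≤ i + 2 := by
          by_contra hlt
          push Not at hlt
          have h := hS₂ T (i + 1) (by omega)
          exact Set.disjoint_left.1 h hS' hin
        have hbandT : band T := ⟨hlev₁, hlev₂⟩
        refine ⟨T', hT'T.trans (Nat.le_succ T), hT'K, ?_⟩
        calc dist (orbit Φ x T') (orbit Φ x (T + 1))
            ≤ dist (orbit Φ x T') (orbit Φ x T) + dist (orbit Φ x T) (orbit Φ x (T + 1)) := dist_triangle _ _ _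
          _ ≤ budget T' T + lam T := by
              rw [orbit_succ, dist_comm (orbit Φ x T)]
              exact add_le_add hdist (hdisp T _)
          _ = budget T' (T + 1) := by
              simp only [hbudget]
              rw [Finset.sum_filter, Finset.sum_filter, Finset.sum_Ico_succ_top hT'T, if_pos hbandT]
  obtain ⟨T', -, hT'K, hdist⟩ := claim T
  exact hmem hT'K (hdist.trans_lt (hbudget_lt T' T))

/-- **Displacement along an orbit**: the distance from the start is at most the sum of the
displacements of the maps that moved the orbit. [folklore] -/
theorem dist_orbit_le [DecidableEq X] (Φ : ℕ → X → X) (lam : ℕ → ℝ)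
    (hdisp : ∀ t x, dist (Φ t x) x ≤ lam t) (x : X) (T : ℕ) :
    dist (orbit Φ x T) x ≤ ∑ t ∈ (Finset.range T).filter (fun t => Φ t (orbit Φ x t) ≠ orbit Φ x t), lam t := by
  induction T with
  | zero => simp
  | succ T ih =>
    rw [Finset.sum_filter, Finset.sum_range_succ, ← Finset.sum_filter]
    by_cases hmove : Φ T (orbit Φ x T) = orbit Φ x T
    · rw [if_neg (not_not.2 hmove), add_zero, orbit_succ, hmove]; exact ih
    · rw [if_pos hmove]
      calc dist (orbit Φ x (T + 1)) x ≤ dist (orbit Φ x (T + 1)) (orbit Φ x T) + dist (orbit Φ x T) x :=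
            dist_triangle _ _ _
        _ ≤ lam T + ∑ t ∈ (Finset.range T).filter (fun t => Φ t (orbit Φ x t) ≠ orbit Φ x t), lam t := by
            rw [orbit_succ]; exact add_le_add (hdisp T _) ih
        _ = _ := by rw [add_comm]

end Orbit

/-! ### Families of pieces -/

section Pieces

variable (n : ℕ) (M : Type*) [TopologicalSpace M]

/-- **A family of cover pieces for the uniqueness induction**: a compact exhaustion `K`, pieces
`P j` (or no-ops) with levels `lev j`, finitely many pieces up to each level, the top ball of a
piece of level `i` inside `interior (K (i+1))` and disjoint from `K i'` for `i' + 2 ≤ i`, the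
cores covering `M`, and the top balls inside both PL chart sources. (Bookkeeping structure, not a
named fact.) [cite: Munkres1966, Thm 10.6] -/
structure UPieces (cD c₁ c₂ : ChartedSpace (𝔼 n) M) where
  /-- the exhaustion -/
  K : CompactExhaustion M
  /-- the pieces -/
  P : ℕ → Option (UPiece n M cD c₁ c₂)
  /-- the levels -/
  lev : ℕ → ℕ
  hfin : ∀ i, {j | (P j).isSome ∧ lev j ≤ i}.Finite
  hwin₁ : ∀ j pc, P j = some pc → pc.MB 9 ⊆ interior (K (lev j + 1))
  hwin₂ : ∀ j pc, P j = some pc → ∀ i, i + 2 ≤ lev j → Disjoint (pc.MB 9) (K i)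
  hcover : ∀ p : M, ∃ j pc, P j = some pc ∧ p ∈ pc.MB 0
  hsrc : ∀ j pc, P j = some pc → pc.MB 9 ⊆ pc.e₁.source ∩ pc.e₂.source

variable {n M}

/-- **Families of pieces exist** on a second countable Hausdorff space carrying the three atlases.
[cite: Munkres1966, Thm 10.6] -/
theorem exists_uPieces [T2Space M] [SecondCountableTopology M] (cD c₁ c₂ : ChartedSpace (𝔼 n) M) :
    Nonempty (UPieces n M cD c₁ c₂) := by
  classical
  haveI : LocallyCompactSpace M := @ChartedSpace.locallyCompactSpace (𝔼 n) M _ _ cD _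
  haveI : SigmaCompactSpace M := sigmaCompactSpace_of_locallyCompact_secondCountable
  set K : CompactExhaustion M := CompactExhaustion.choice M with hK
  -- windows and shells
  set W : ℕ → Set M := fun i => interior (K (i + 1)) ∩ {q | ∀ i', i' + 2 ≤ i → q ∉ K i'} with hW
  set D : ℕ → Set M := fun i => K i ∩ {q | ∀ i', i' + 1 ≤ i → q ∉ interior (K i')} with hD
  have hWo : ∀ i, IsOpen (W i) := fun i => by
    have : {q : M | ∀ i', i' + 2 ≤ i → q ∉ K i'} = ⋂ i' ∈ Finset.range (i - 1), (K i')ᶜ := by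
      ext q
      simp only [mem_setOf_eq, mem_iInter, mem_compl_iff, Finset.mem_range]
      constructor
      · intro h i' hi'; exact h i' (by omega)
      · intro h i' hi'; exact h i' (by omega)
    rw [hW]
    simp only
    rw [this]
    exact isOpen_interior.inter (isOpen_biInter_finset fun i' _ => (K.isCompact i').isClosed.isOpen_compl)
  have hDc : ∀ i, IsCompact (D i) := fun i => by
    have : {q : M | ∀ i', i' + 1 ≤ i → q ∉ interior (K i')} = ⋂ i' ∈ Finset.range i, (interior (K i'))ᶜ := by
      ext q
      simp only [mem_setOf_eq, mem_iInter, mem_compl_iff, Finset.mem_range]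
      constructor
      · intro h i' hi'; exact h i' (by omega)
      · intro h i' hi'; exact h i' (by omega)
    rw [hD]
    simp only
    rw [this]
    exact (K.isCompact i).inter_right (isClosed_biInter fun i' _ => isOpen_interior.isClosed_compl)
  have hDW : ∀ i, D i ⊆ W i := fun i q hq => by
    refine ⟨K.subset_interior_succ i hq.1, fun i' hi' hqi' => ?_⟩
    exact hq.2 (i' + 1) (by omega) (K.subset_interior_succ i' hqi')
  have hDcov : ∀ q : M, ∃ i, q ∈ D i := fun q => by
    refine ⟨K.find q, K.mem_find q, fun i' hi' hq => ?_⟩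
    have : K.find q ≤ i' := K.mem_iff_find_le.1 (interior_subset hq)
    omega
  -- the piece at a point of a shell
  have hpiece : ∀ i, ∀ p ∈ D i, ∃ pc : UPiece n M cD c₁ c₂, p ∈ pc.ψ.source ∧ pc.ψ p ∈ ball pc.z (pc.ρ 0) ∧
      pc.MB 9 ⊆ W i ∧ pc.MB 9 ⊆ pc.e₁.source ∩ pc.e₂.source := by
    intro i p hp
    set ψ := @chartAt (𝔼 n) _ M _ cD p with hψ
    set e₁ := @chartAt (𝔼 n) _ M _ c₁ p with he₁
    set e₂ := @chartAt (𝔼 n) _ M _ c₂ p with he₂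
    have hpψ : p ∈ ψ.source := @mem_chart_source (𝔼 n) M _ _ cD p
    have hpe₁ : p ∈ e₁.source := @mem_chart_source (𝔼 n) M _ _ c₁ p
    have hpe₂ : p ∈ e₂.source := @mem_chart_source (𝔼 n) M _ _ c₂ p
    set O : Set (𝔼 n) := ψ.target ∩ ψ.symm ⁻¹' (e₁.source ∩ e₂.source ∩ W i) with hO
    have hOo : IsOpen O := ψ.isOpen_inter_preimage_symm ((e₁.open_source.inter e₂.open_source).inter (hWo i))
    have hpO : ψ p ∈ O := ⟨ψ.map_source hpψ, by
      show ψ.symm (ψ p) ∈ e₁.source ∩ e₂.source ∩ W i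
      rw [ψ.left_inv hpψ]; exact ⟨⟨hpe₁, hpe₂⟩, hDW i hp⟩⟩
    obtain ⟨r₀, hr₀, hball⟩ := Metric.isOpen_iff.1 hOo _ hpO
    set r : ℝ := r₀ / 2 with hr
    have hr0 : 0 < r := by positivity
    have hcb : closedBall (ψ p) r ⊆ O := (closedBall_subset_ball (by rw [hr]; linarith)).trans hball
    set pc : UPiece n M cD c₁ c₂ :=
      { ψ := ψ, hψ := @chart_mem_atlas (𝔼 n) M _ _ cD p, e₁ := e₁, he₁ := @chart_mem_atlas (𝔼 n) M _ _ c₁ p,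
        e₂ := e₂, he₂ := @chart_mem_atlas (𝔼 n) M _ _ c₂ p, z := ψ p,
        ρ := fun ℓ => r * ((ℓ : ℕ) + 1) / 10, η := r / 10, hη := by positivity,
        hρ0 := by simp only [Fin.val_zero, Nat.cast_zero, zero_add, mul_one]; positivity,
        hρ := fun ℓ => le_of_eq (by simp only [Fin.val_castSucc, Fin.val_succ]; push_cast; ring),
        htarget := by
          have : r * ((((9 : Fin 10) : ℕ) : ℝ) + 1) / 10 = r := by norm_num
          rw [this]; exact hcb.trans inter_subset_left } with hpc
    have hρ9 : pc.ρ 9 = r := by show r * ((((9 : Fin 10) : ℕ) : ℝ) + 1) / 10 = r; norm_num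
    have hMB9 : pc.MB 9 ⊆ e₁.source ∩ e₂.source ∩ W i := by
      rintro _ ⟨w, hw, rfl⟩
      have hw' : w ∈ closedBall (ψ p) r := by
        have : w ∈ closedBall pc.z (pc.ρ 9) := hw
        rwa [hρ9] at this
      exact (hcb hw').2
    refine ⟨pc, hpψ, ?_, fun q hq => (hMB9 hq).2, fun q hq => (hMB9 hq).1⟩
    show ψ p ∈ ball (ψ p) (r * ((((0 : Fin 10) : ℕ) : ℝ) + 1) / 10)
    exact mem_ball_self (by simp only [Fin.val_zero, Nat.cast_zero, zero_add, mul_one]; positivity)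
  choose pcs hpcψ hpcball hpcW hpcsrc using hpiece
  -- finite subcovers of the shells by the open cores
  have hsub : ∀ i, ∃ t : Finset ↥(D i), D i ⊆ ⋃ p ∈ t,
      (pcs i p p.2).ψ.symm '' ball (pcs i p p.2).z ((pcs i p p.2).ρ 0) := by
    intro i
    refine (hDc i).elim_nhds_subcover' (fun p hp => (pcs i p hp).ψ.symm '' ball (pcs i p hp).z ((pcs i p hp).ρ 0))
      fun p hp => ?_
    have hopen : IsOpen ((pcs i p hp).ψ.symm '' ball (pcs i p hp).z ((pcs i p hp).ρ 0)) :=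
      (pcs i p hp).ψ.symm.isOpen_image_of_subset_source isOpen_ball (by
        rw [(pcs i p hp).ψ.symm_source]; exact ball_subset_closedBall.trans ((pcs i p hp).B_subset_target 0))
    exact hopen.mem_nhds ⟨(pcs i p hp).ψ p, hpcball i p hp, (pcs i p hp).ψ.left_inv (hpcψ i p hp)⟩
  choose t htcov using hsub
  -- enumeration of the pieces
  set pcOf : ∀ i : ℕ, Fin (t i).card → UPiece n M cD c₁ c₂ := fun i m =>
    pcs i ((t i).equivFin.symm m).1.1 ((t i).equivFin.symm m).1.2 with hpcOf
  set Q : ℕ × ℕ → Option (UPiece n M cD c₁ c₂) := fun im =>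
    if h : im.2 < (t im.1).card then some (pcOf im.1 ⟨im.2, h⟩) else none with hQ
  set P : ℕ → Option (UPiece n M cD c₁ c₂) := fun j => Q (Nat.unpair j) with hP
  have hPsome : ∀ j pc, P j = some pc → ∃ h : (Nat.unpair j).2 < (t (Nat.unpair j).1).card,
      pc = pcOf (Nat.unpair j).1 ⟨(Nat.unpair j).2, h⟩ := by
    intro j pc hj
    simp only [hP, hQ] at hj
    split_ifs at hj with h
    · exact ⟨h, (Option.some.inj hj).symm⟩
  have hPpair : ∀ i (m : Fin (t i).card), P (Nat.pair i m) = some (pcOf i m) := by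
    intro i m
    show Q (Nat.unpair (Nat.pair i m)) = _
    rw [Nat.unpair_pair]
    simp only [hQ, dif_pos m.2]
  refine ⟨{ K := K, P := P, lev := fun j => (Nat.unpair j).1, hfin := fun i => ?_, hwin₁ := ?_, hwin₂ := ?_,
            hcover := fun q => ?_, hsrc := ?_ }⟩
  · -- finiteness
    refine (((Finset.range (i + 1)).biUnion fun i' => (Finset.range (t i').card).image (Nat.pair i')).finite_toSet).subset ?_
    rintro j ⟨hj, hjle⟩
    simp only [Finset.coe_biUnion, Finset.coe_range, Finset.coe_image, mem_iUnion, mem_image, mem_Iio, exists_prop]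
    obtain ⟨pc, hpc⟩ := Option.isSome_iff_exists.1 hj
    obtain ⟨h, -⟩ := hPsome j pc hpc
    exact ⟨(Nat.unpair j).1, by simpa using Nat.lt_succ_of_le hjle, (Nat.unpair j).2, h, Nat.pair_unpair j⟩
  · intro j pc hj
    obtain ⟨h, rfl⟩ := hPsome j pc hj
    exact fun q hq => (hpcW _ _ _ hq).1
  · intro j pc hj i' hi'
    obtain ⟨h, rfl⟩ := hPsome j pc hj
    exact Set.disjoint_left.2 fun q hq hqi => (hpcW _ _ _ hq).2 i' hi' hqi
  · -- cover
    obtain ⟨i, hqi⟩ := hDcov q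
    obtain ⟨p', hp't, hq'⟩ := mem_iUnion₂.1 (htcov i hqi)
    set m : Fin (t i).card := (t i).equivFin ⟨p', hp't⟩ with hm
    refine ⟨Nat.pair i m, pcOf i m, hPpair i m, ?_⟩
    have hpm : (t i).equivFin.symm m = ⟨p', hp't⟩ := by rw [hm, Equiv.symm_apply_apply]
    have : pcOf i m = pcs i p' p'.2 := by
      simp only [hpcOf, hpm]
    rw [this]
    obtain ⟨w, hw, rfl⟩ := hq'
    exact ⟨w, ball_subset_closedBall hw, rfl⟩
  · intro j pc hj
    obtain ⟨h, rfl⟩ := hPsome j pc hj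
    exact hpcsrc _ _ _

end Pieces

/-! ### The constants of the induction -/

section Constants

variable {n : ℕ} {M : Type*} [TopologicalSpace M] [TopologicalSpace.MetrizableSpace M]
  {cD c₁ c₂ : ChartedSpace (𝔼 n) M} (Pc : UPieces n M cD c₁ c₂)

namespace UPieces

/-- A geometric bound: `∑_{t ∈ s} (1/2)^(t+2) ≤ 1/2` for any finite set of naturals. [folklore] -/
theorem sum_half_pow_le (s : Finset ℕ) : ∑ t ∈ s, (1 / 2 : ℝ) ^ (t + 2) ≤ 1 / 2 := by
  have hsum : Summable fun t : ℕ => (1 / 2 : ℝ) ^ (t + 2) := by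
    have : (fun t : ℕ => (1 / 2 : ℝ) ^ (t + 2)) = fun t => (1 / 4 : ℝ) * (1 / 2) ^ t := by
      funext t; rw [pow_add]; ring
    rw [this]
    exact summable_geometric_two.mul_left _
  have htsum : ∑' t : ℕ, (1 / 2 : ℝ) ^ (t + 2) = 1 / 2 := by
    have : (fun t : ℕ => (1 / 2 : ℝ) ^ (t + 2)) = fun t => (1 / 4 : ℝ) * (1 / 2) ^ t := by
      funext t; rw [pow_add]; ring
    rw [this, tsum_mul_left, tsum_geometric_two]; norm_num
  calc ∑ t ∈ s, (1 / 2 : ℝ) ^ (t + 2) ≤ ∑' t : ℕ, (1 / 2 : ℝ) ^ (t + 2) :=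
        hsum.sum_le_tsum s fun t _ => by positivity
    _ = 1 / 2 := htsum

/-- **Gaps of the exhaustion**: `gap i > 0` with the `gap i`-neighbourhood of `K i` inside
`K (i+1)` (for the metric `TopologicalSpace.metrizableSpaceMetric M`). [folklore] -/
theorem exists_gap (i : ℕ) : ∃ δ > 0, ∀ x ∈ Pc.K i, ∀ y : M,
    (letI := TopologicalSpace.metrizableSpaceMetric M; dist x y ≤ δ) → y ∈ Pc.K (i + 1) := by
  letI := TopologicalSpace.metrizableSpaceMetric M
  obtain ⟨δ, hδ, hsub⟩ := (Pc.K.isCompact i).exists_cthickening_subset_open isOpen_interior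
    (Pc.K.subset_interior_succ i)
  refine ⟨δ, hδ, fun x hx y hxy => interior_subset (hsub ?_)⟩
  exact mem_cthickening_of_dist_le y x δ _ hx (by rw [dist_comm]; exact hxy)

/-- The gap of level `i` (a choice). [folklore] -/
def gap (i : ℕ) : ℝ := (Pc.exists_gap i).choose

/-- Auxiliary (`gap_pos`). [folklore] -/
theorem gap_pos (i : ℕ) : 0 < Pc.gap i := (Pc.exists_gap i).choose_spec.1

/-- Auxiliary (`gap_spec`). [folklore] -/
theorem gap_spec (i : ℕ) : ∀ x ∈ Pc.K i, ∀ y : M,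
    (letI := TopologicalSpace.metrizableSpaceMetric M; dist x y ≤ Pc.gap i) → y ∈ Pc.K (i + 1) :=
  (Pc.exists_gap i).choose_spec.2

/-- **Chart margins**: for a piece `j`, `cmar j > 0` with the `cmar j`-neighbourhood of its top
ball inside both PL chart sources. [folklore] -/
theorem exists_cmar (j : ℕ) : ∃ μ > 0, ∀ pc, Pc.P j = some pc → ∀ x ∈ pc.MB 9, ∀ y : M,
    (letI := TopologicalSpace.metrizableSpaceMetric M; dist x y ≤ μ) → y ∈ pc.e₁.source ∩ pc.e₂.source := by
  letI := TopologicalSpace.metrizableSpaceMetric M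
  rcases hP : Pc.P j with _ | pc
  · exact ⟨1, one_pos, fun pc h => by simp at h⟩
  · obtain ⟨μ, hμ, hsub⟩ := (pc.isCompact_MB 9).exists_cthickening_subset_open
      (pc.e₁.open_source.inter pc.e₂.open_source) (Pc.hsrc j pc hP)
    refine ⟨μ, hμ, fun pc' h x hx y hxy => ?_⟩
    cases Option.some.inj h
    exact hsub (mem_cthickening_of_dist_le y x μ _ hx (by rw [dist_comm]; exact hxy))

/-- The chart margin of piece `j` (a choice). [folklore] -/
def cmar (j : ℕ) : ℝ := (Pc.exists_cmar j).choose

/-- Auxiliary (`cmar_pos`). [folklore] -/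
theorem cmar_pos (j : ℕ) : 0 < Pc.cmar j := (Pc.exists_cmar j).choose_spec.1

/-- Auxiliary (`cmar_spec`). [folklore] -/
theorem cmar_spec (j : ℕ) : ∀ pc, Pc.P j = some pc → ∀ x ∈ pc.MB 9, ∀ y : M,
    (letI := TopologicalSpace.metrizableSpaceMetric M; dist x y ≤ Pc.cmar j) → y ∈ pc.e₁.source ∩ pc.e₂.source :=
  (Pc.exists_cmar j).choose_spec.2

/-- The gap part of the displacement bound of stage `j`: the least gap of the levels
`lev j - 2, …, lev j` (and `≤ 1`). [folklore] -/
def bδ (j : ℕ) : ℝ := (Finset.Icc (Pc.lev j - 2) (Pc.lev j)).fold min 1 Pc.gap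

/-- The chart part of the displacement bound of stage `j`: the least chart margin of the pieces of
levels within `3` of `lev j` (and `≤ 1`). [folklore] -/
def bμ (j : ℕ) : ℝ :=
  ((Pc.hfin (Pc.lev j + 3)).toFinset.filter fun k => Pc.lev j ≤ Pc.lev k + 3).fold min 1 Pc.cmar

/-- **The displacement bound of stage `j`**: `lam j = 2^{-(j+2)} · min (bδ j) (bμ j)`. [folklore] -/
def lam (j : ℕ) : ℝ := (1 / 2 : ℝ) ^ (j + 2) * min (Pc.bδ j) (Pc.bμ j)

/-- Auxiliary (`bδ_pos`). [folklore] -/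
theorem bδ_pos (j : ℕ) : 0 < Pc.bδ j := by
  rw [bδ, Finset.lt_fold_min]
  exact ⟨one_pos, fun i _ => Pc.gap_pos i⟩

/-- Auxiliary (`bμ_pos`). [folklore] -/
theorem bμ_pos (j : ℕ) : 0 < Pc.bμ j := by
  rw [bμ, Finset.lt_fold_min]
  exact ⟨one_pos, fun k _ => Pc.cmar_pos k⟩

/-- Auxiliary (`lam_pos`). [folklore] -/
theorem lam_pos (j : ℕ) : 0 < Pc.lam j := by
  have := Pc.bδ_pos j; have := Pc.bμ_pos j
  unfold lam; positivity

/-- Auxiliary (`lam_nonneg`). [folklore] -/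
theorem lam_nonneg (j : ℕ) : 0 ≤ Pc.lam j := (Pc.lam_pos j).le

/-- `lam j ≤ 2^{-(j+2)} · gap i` for the levels `i` of the band of `j`. [folklore] -/
theorem lam_le_gap {j i : ℕ} (h₁ : i ≤ Pc.lev j) (h₂ : Pc.lev j ≤ i + 2) :
    Pc.lam j ≤ (1 / 2 : ℝ) ^ (j + 2) * Pc.gap i := by
  have hb : Pc.bδ j ≤ Pc.gap i := by
    rw [bδ, Finset.fold_min_le]
    exact Or.inr ⟨i, Finset.mem_Icc.2 ⟨by omega, h₁⟩, le_rfl⟩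
  unfold lam
  exact mul_le_mul_of_nonneg_left ((min_le_left _ _).trans hb) (by positivity)

/-- `lam j ≤ 2^{-(j+2)} · cmar k` for the pieces `k` of levels within `3` of `lev j`. [folklore] -/
theorem lam_le_cmar {j k : ℕ} (hk : (Pc.P k).isSome) (h₁ : Pc.lev k ≤ Pc.lev j + 3)
    (h₂ : Pc.lev j ≤ Pc.lev k + 3) : Pc.lam j ≤ (1 / 2 : ℝ) ^ (j + 2) * Pc.cmar k := by
  have hb : Pc.bμ j ≤ Pc.cmar k := by
    rw [bμ, Finset.fold_min_le]
    refine Or.inr ⟨k, Finset.mem_filter.2 ⟨(Pc.hfin _).mem_toFinset.2 ⟨hk, h₁⟩, h₂⟩, le_rfl⟩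
  unfold lam
  exact mul_le_mul_of_nonneg_left ((min_le_right _ _).trans hb) (by positivity)

/-- **The band sums are at most half the gaps.** [folklore] -/
theorem sum_lam_le_half_gap (i : ℕ) (s : Finset ℕ) (hs : ∀ t ∈ s, i ≤ Pc.lev t ∧ Pc.lev t ≤ i + 2) :
    ∑ t ∈ s, Pc.lam t ≤ Pc.gap i / 2 := by
  calc ∑ t ∈ s, Pc.lam t ≤ ∑ t ∈ s, (1 / 2 : ℝ) ^ (t + 2) * Pc.gap i :=
        Finset.sum_le_sum fun t ht => Pc.lam_le_gap (hs t ht).1 (hs t ht).2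
    _ = (∑ t ∈ s, (1 / 2 : ℝ) ^ (t + 2)) * Pc.gap i := by rw [Finset.sum_mul]
    _ ≤ 1 / 2 * Pc.gap i := mul_le_mul_of_nonneg_right (sum_half_pow_le s) (Pc.gap_pos i).le
    _ = Pc.gap i / 2 := by ring

/-- **The band sums are below the gaps.** [folklore] -/
theorem sum_lam_lt_gap (i : ℕ) (s : Finset ℕ) (hs : ∀ t ∈ s, i ≤ Pc.lev t ∧ Pc.lev t ≤ i + 2) :
    ∑ t ∈ s, Pc.lam t < Pc.gap i := (Pc.sum_lam_le_half_gap i s hs).trans_lt (by linarith [Pc.gap_pos i])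

/-- **The band sums are below half the chart margins.** [folklore] -/
theorem sum_lam_le_cmar {k : ℕ} (hk : (Pc.P k).isSome) (s : Finset ℕ)
    (hs : ∀ t ∈ s, Pc.lev k ≤ Pc.lev t + 3 ∧ Pc.lev t ≤ Pc.lev k + 3) :
    ∑ t ∈ s, Pc.lam t ≤ Pc.cmar k / 2 := by
  calc ∑ t ∈ s, Pc.lam t ≤ ∑ t ∈ s, (1 / 2 : ℝ) ^ (t + 2) * Pc.cmar k :=
        Finset.sum_le_sum fun t ht => Pc.lam_le_cmar hk (hs t ht).1 (hs t ht).2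
    _ = (∑ t ∈ s, (1 / 2 : ℝ) ^ (t + 2)) * Pc.cmar k := by rw [Finset.sum_mul]
    _ ≤ 1 / 2 * Pc.cmar k := mul_le_mul_of_nonneg_right (sum_half_pow_le s) (Pc.cmar_pos k).le
    _ = Pc.cmar k / 2 := by ring

/-- **The chart tolerance of a piece**: `ε > 0` such that chart points of the top ball within `ε`
of each other have `ψ.symm`-images within `lam j` (uniform continuity on the compact ball).
[folklore] -/
theorem exists_eps (j : ℕ) : ∃ ε > 0, ∀ pc, Pc.P j = some pc → ∀ w ∈ pc.B 9, ∀ w' ∈ pc.B 9,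
    dist w w' < ε → (letI := TopologicalSpace.metrizableSpaceMetric M; dist (pc.ψ.symm w) (pc.ψ.symm w') < Pc.lam j) := by
  letI := TopologicalSpace.metrizableSpaceMetric M
  rcases hP : Pc.P j with _ | pc
  · exact ⟨1, one_pos, fun pc h => by simp at h⟩
  · have huc := (pc.isCompact_B 9).uniformContinuousOn_of_continuous
      (pc.ψ.continuousOn_symm.mono (pc.B_subset_target 9))
    obtain ⟨ε, hε, h⟩ := Metric.uniformContinuousOn_iff.1 huc (Pc.lam j) (Pc.lam_pos j)
    refine ⟨ε, hε, fun pc' h' w hw w' hw' hww' => ?_⟩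
    cases Option.some.inj h'
    exact h w hw w' hw' hww'

/-- The chart tolerance of piece `j` (a choice). [folklore] -/
def eps (j : ℕ) : ℝ := (Pc.exists_eps j).choose

/-- Auxiliary (`eps_pos`). [folklore] -/
theorem eps_pos (j : ℕ) : 0 < Pc.eps j := (Pc.exists_eps j).choose_spec.1

/-- Auxiliary (`eps_spec`). [folklore] -/
theorem eps_spec (j : ℕ) : ∀ pc, Pc.P j = some pc → ∀ w ∈ pc.B 9, ∀ w' ∈ pc.B 9,
    dist w w' < Pc.eps j → (letI := TopologicalSpace.metrizableSpaceMetric M; dist (pc.ψ.symm w) (pc.ψ.symm w') < Pc.lam j) :=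
  (Pc.exists_eps j).choose_spec.2

end UPieces

end Constants

end Literature.Topology.FourManifolds
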